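import Summits.AtomisticToContinuum.Crystallization.Theorems.FreeSplittingCertificatesStrictSplittingRuleP1Volume

/-!
# `StrictSplittingRule` (stmt-AtomisticToContinuum-12560): FIRST MOMENTS of the reference pieces — `∫_{piece} λ_m = 1/24` by unimodular symmetry (P1 interpolant object, part 20)

Route `FreeSplittingCertificates`, crux r3 `StrictSplittingRule` (H12⋆ = `stub_coreJointCoercive`), unit b2b-freesplit-B gen 22.
VALUE = the first brick of the DEMAND side of the transfer (item (2''') of HOME FAR-LEMMA-SPEC §17 (c),(e)): the hat functions of the P1
interpolant have cell integrals `|cell|/4` — the fact behind the vertex quadrature / Jensen comparisons of lattice point values with element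
integrals.  Proved WITHOUT computing a single simplex integral: the affine map `σ(p) = (λ₀(p), λ₁(p), λ₂(p))` of the corner simplex `K` permutes
its four barycentric coordinates cyclically, is unimodular (volume preserving) and maps `K` onto itself, so the four integrals `∫_K λ_m` are
equal and sum to `|K| = 1/6` (`volume_p1RefCell`); the other eleven reference pieces are unimodular affine images of `K` with matching
barycentric coordinates (`p1RefMap`, `p1Bary_p1RefMap`, part 9).
* `p1Cyc`, `p1Bary_p1Cyc` (`λ_{m+1} ∘ σ = λ_m`), `p1Cyc_mem_iff`, `measurePreserving_p1Cyc`;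
* **`setIntegral_p1Bary_corner`**: `∫ p in p1RefCell true 0, p1Bary true 0 m p = 1/24` for every `m`;
* **`setIntegral_p1Bary_p1RefCell`**: the same for every reference piece `(e, π)`.
NOT a proof of H12⋆, NOT summit progress.  [folklore]
-/

noncomputable section

open Set Function Metric MeasureTheory Filter Topology
open scoped BigOperators NNReal ENNReal

namespace Summit.AtomisticToContinuum.Crystallization.Theorems.StrictSplittingRuleBirth

/-! ## The cyclic symmetry of the corner simplex -/

/-- The linear part of the cyclic symmetry: `p ↦ (−p₀−p₁−p₂, p₀, p₁)`. -/
def p1CycLin : (Fin 3 → ℝ) →ₗ[ℝ] (Fin 3 → ℝ) where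
  toFun p := ![-(p 0 + p 1 + p 2), p 0, p 1]
  map_add' p q := by ext i; fin_cases i <;> (simp; try ring)
  map_smul' c p := by ext i; fin_cases i <;> (simp; try ring)

/-- The cyclic symmetry of the corner simplex: `σ(p) = (1 − p₀ − p₁ − p₂, p₀, p₁)` (vertex `0 ↦ e₁ ↦ e₂ ↦ e₃ ↦ 0`). -/
def p1Cyc (p : Fin 3 → ℝ) : Fin 3 → ℝ := ![1, 0, 0] + p1CycLin p

/-- First component of `σ`. -/
@[simp] theorem p1Cyc_apply_zero (p : Fin 3 → ℝ) : p1Cyc p 0 = 1 - (p 0 + p 1 + p 2) := by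
  simp [p1Cyc, p1CycLin]; ring
/-- Second component of `σ`. -/
@[simp] theorem p1Cyc_apply_one (p : Fin 3 → ℝ) : p1Cyc p 1 = p 0 := by simp [p1Cyc, p1CycLin]
/-- Third component of `σ`. -/
@[simp] theorem p1Cyc_apply_two (p : Fin 3 → ℝ) : p1Cyc p 2 = p 1 := by simp [p1Cyc, p1CycLin]

/-- The barycentric coordinates of the corner simplex, explicitly. -/
theorem p1Bary_corner (m : Fin 4) (p : Fin 3 → ℝ) :
    p1Bary true 0 m p = if m = 0 then 1 - (p 0 + p 1 + p 2) else if m = 1 then p 0 else if m = 2 then p 1 else p 2 := by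
  fin_cases m <;> (simp [p1Bary, p1BaryCoef]; try ring)

/-- **`σ` permutes the barycentric coordinates cyclically**: `λ_{m+1}(σ p) = λ_m(p)`. -/
theorem p1Bary_p1Cyc (m : Fin 4) (p : Fin 3 → ℝ) : p1Bary true 0 (m + 1) (p1Cyc p) = p1Bary true 0 m p := by
  fin_cases m <;> (simp [p1Bary_corner]; try ring)

/-- `σ` maps the corner simplex into itself (all barycentric coordinates stay nonnegative). -/
theorem p1Cyc_mem_iff (p : Fin 3 → ℝ) : p1Cyc p ∈ p1RefCell true 0 ↔ p ∈ p1RefCell true 0 := by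
  simp only [p1RefCell, mem_setOf_eq]
  constructor
  · intro h m
    have := h (m + 1)
    rwa [p1Bary_p1Cyc] at this
  · intro h m
    have e : m = (m - 1) + 1 := (sub_add_cancel m 1).symm
    rw [e, p1Bary_p1Cyc]
    exact h _

/-- The linear part has determinant `−1`. -/
theorem det_p1CycLin : LinearMap.det p1CycLin = -1 := by
  rw [← LinearMap.det_toMatrix', Matrix.det_fin_three]
  simp [LinearMap.toMatrix'_apply, p1CycLin, Matrix.cons_val_zero, Matrix.cons_val_one]

/-- **`σ` preserves Lebesgue measure** (unimodular linear part, then a translation). -/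
theorem measurePreserving_p1Cyc : MeasurePreserving p1Cyc volume volume := by
  have hdet : LinearMap.det p1CycLin ≠ 0 := by rw [det_p1CycLin]; norm_num
  have hL : MeasurePreserving p1CycLin volume volume := by
    refine ⟨p1CycLin.continuous_of_finiteDimensional.measurable, ?_⟩
    rw [Measure.map_linearMap_addHaar_eq_smul_addHaar volume hdet, det_p1CycLin]
    simp
  have hT : MeasurePreserving (fun x : Fin 3 → ℝ => ![(1 : ℝ), 0, 0] + x) volume volume := measurePreserving_add_left volume _
  exact hT.comp hL

/-! ## First moments of the corner simplex -/

/-- The barycentric coordinates are integrable on the corner simplex. -/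
theorem integrableOn_p1Bary_corner (e : Bool) (π : Fin 6) (m : Fin 4) (e' : Bool) (π' : Fin 6) :
    IntegrableOn (fun p => p1Bary e π m p) (p1RefCell e' π') volume := by
  have hK : IsCompact (p1RefCell e' π') := by
    refine (isCompact_Icc (a := (0 : Fin 3 → ℝ)) (b := 1)).of_isClosed_subset (isClosed_p1RefCell e' π') fun p hp => ?_
    exact ⟨fun i => (p1RefCell_subset_cube hp i).1, fun i => (p1RefCell_subset_cube hp i).2⟩
  have hc : Continuous fun p : Fin 3 → ℝ => p1Bary e π m p := by
    unfold p1Bary; fun_prop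
  exact hc.continuousOn.integrableOn_compact hK

/-- All four first moments of the corner simplex are equal (cyclic symmetry + measure preservation). -/
theorem setIntegral_p1Bary_corner_succ (m : Fin 4) :
    ∫ p in p1RefCell true 0, p1Bary true 0 (m + 1) p = ∫ p in p1RefCell true 0, p1Bary true 0 m p := by
  have hmeas : MeasurableSet (p1RefCell true 0) := (isClosed_p1RefCell true 0).measurableSet
  rw [← integral_indicator hmeas, ← integral_indicator hmeas]
  have hind : (fun p => (p1RefCell true 0).indicator (fun p => p1Bary true 0 m p) p) =
      fun p => ((p1RefCell true 0).indicator (fun q => p1Bary true 0 (m + 1) q)) (p1Cyc p) := by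
    funext p
    by_cases hp : p ∈ p1RefCell true 0
    · rw [indicator_of_mem hp, indicator_of_mem ((p1Cyc_mem_iff p).2 hp), p1Bary_p1Cyc]
    · rw [indicator_of_notMem hp, indicator_of_notMem (fun h => hp ((p1Cyc_mem_iff p).1 h))]
  rw [hind]
  have hf : AEStronglyMeasurable (fun q => (p1RefCell true 0).indicator (fun q => p1Bary true 0 (m + 1) q) q)
      (Measure.map p1Cyc volume) := by
    rw [measurePreserving_p1Cyc.map_eq]
    exact ((integrableOn_p1Bary_corner true 0 (m + 1) true 0).integrable_indicator hmeas).aestronglyMeasurable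
  rw [← integral_map measurePreserving_p1Cyc.measurable.aemeasurable hf, measurePreserving_p1Cyc.map_eq]

/-- **First moments of the corner simplex: `∫_K λ_m = 1/24`** for each of the four barycentric coordinates. -/
theorem setIntegral_p1Bary_corner (m : Fin 4) : ∫ p in p1RefCell true 0, p1Bary true 0 m p = 1 / 24 := by
  have h1 : ∫ p in p1RefCell true 0, p1Bary true 0 1 p = ∫ p in p1RefCell true 0, p1Bary true 0 0 p := by
    simpa using setIntegral_p1Bary_corner_succ 0
  have h2 : ∫ p in p1RefCell true 0, p1Bary true 0 2 p = ∫ p in p1RefCell true 0, p1Bary true 0 1 p := by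
    simpa using setIntegral_p1Bary_corner_succ 1
  have h3 : ∫ p in p1RefCell true 0, p1Bary true 0 3 p = ∫ p in p1RefCell true 0, p1Bary true 0 2 p := by
    simpa using setIntegral_p1Bary_corner_succ 2
  have i0 := integrableOn_p1Bary_corner true 0 0 true 0
  have i1 := integrableOn_p1Bary_corner true 0 1 true 0
  have i2 := integrableOn_p1Bary_corner true 0 2 true 0
  have i3 := integrableOn_p1Bary_corner true 0 3 true 0
  have hsum : (∫ p in p1RefCell true 0, p1Bary true 0 0 p) + (∫ p in p1RefCell true 0, p1Bary true 0 1 p) +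
      (∫ p in p1RefCell true 0, p1Bary true 0 2 p) + (∫ p in p1RefCell true 0, p1Bary true 0 3 p) = 1 / 6 := by
    have i01 : IntegrableOn (fun p => p1Bary true 0 0 p + p1Bary true 0 1 p) (p1RefCell true 0) volume := i0.add i1
    have i012 : IntegrableOn (fun p => p1Bary true 0 0 p + p1Bary true 0 1 p + p1Bary true 0 2 p) (p1RefCell true 0) volume := i01.add i2
    rw [← integral_add i0 i1, ← integral_add i01 i2, ← integral_add i012 i3]
    have e : (fun p : Fin 3 → ℝ => p1Bary true 0 0 p + p1Bary true 0 1 p + p1Bary true 0 2 p + p1Bary true 0 3 p) = fun _ => (1 : ℝ) := by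
      funext p; simp [p1Bary, p1BaryCoef]; ring
    rw [e, setIntegral_const, measureReal_def, volume_p1RefCell, smul_eq_mul, mul_one, ENNReal.toReal_inv]
    norm_num
  fin_cases m <;> simp only [Fin.zero_eta, Fin.mk_one, Fin.reduceFinMk] <;> linarith

/-! ## First moments of every reference piece -/

/-- The reference maps preserve Lebesgue measure (unimodular linear part + translation). -/
theorem measurePreserving_p1RefMap (e : Bool) (π : Fin 6) : MeasurePreserving (p1RefMap e π) volume volume := by
  have hdet : LinearMap.det (p1RefLin e π) ≠ 0 := fun h0 => by
    have := abs_det_p1RefLin e π; rw [h0, abs_zero] at this; exact zero_ne_one this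
  have hL : MeasurePreserving (p1RefLin e π) volume volume := by
    refine ⟨(p1RefLin e π).continuous_of_finiteDimensional.measurable, ?_⟩
    rw [Measure.map_linearMap_addHaar_eq_smul_addHaar volume hdet, abs_inv, abs_det_p1RefLin]
    simp
  have hT : MeasurePreserving (fun x : Fin 3 → ℝ => p1Vec (p1VertOff e π 0) + x) volume volume := measurePreserving_add_left volume _
  exact hT.comp hL

/-- Membership is transported by the reference map through the barycentric coordinates. -/
theorem p1RefMap_mem_iff (e : Bool) (π : Fin 6) (p : Fin 3 → ℝ) : p1RefMap e π p ∈ p1RefCell e π ↔ p ∈ p1RefCell true 0 := by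
  simp only [p1RefCell, mem_setOf_eq, p1Bary_p1RefMap]

/-- **First moments of every reference piece: `∫_{piece (e,π)} λ_m = 1/24`.**  NOT a proof of H12⋆, NOT summit progress. -/
theorem setIntegral_p1Bary_p1RefCell (e : Bool) (π : Fin 6) (m : Fin 4) : ∫ p in p1RefCell e π, p1Bary e π m p = 1 / 24 := by
  have hmeas : MeasurableSet (p1RefCell e π) := (isClosed_p1RefCell e π).measurableSet
  have hmeas0 : MeasurableSet (p1RefCell true 0) := (isClosed_p1RefCell true 0).measurableSet
  rw [← setIntegral_p1Bary_corner m, ← integral_indicator hmeas, ← integral_indicator hmeas0]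
  have hind : (fun p => (p1RefCell true 0).indicator (fun p => p1Bary true 0 m p) p) =
      fun p => ((p1RefCell e π).indicator (fun q => p1Bary e π m q)) (p1RefMap e π p) := by
    funext p
    by_cases hp : p ∈ p1RefCell true 0
    · rw [indicator_of_mem hp, indicator_of_mem ((p1RefMap_mem_iff e π p).2 hp), p1Bary_p1RefMap]
    · rw [indicator_of_notMem hp, indicator_of_notMem (fun h => hp ((p1RefMap_mem_iff e π p).1 h))]
  rw [hind]
  have hMP := measurePreserving_p1RefMap e π
  have hf : AEStronglyMeasurable (fun q => (p1RefCell e π).indicator (fun q => p1Bary e π m q) q) (Measure.map (p1RefMap e π) volume) := by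
    rw [hMP.map_eq]
    exact ((integrableOn_p1Bary_corner e π m e π).integrable_indicator hmeas).aestronglyMeasurable
  rw [← integral_map hMP.measurable.aemeasurable hf, hMP.map_eq]

/-! ## First moments of the real cells: `∫_{cell} λ_m = |cell|/4` -/

/-- **First moments of the real cells (affine form of the barycentric coordinate)**: for the cell `i = (n, π)` and each vertex `m`,
`∫_{cell} λ_m(c + L y) dy = √3·a²·h/48 = |cell|/4`, where `T⁻¹ y − p1Vec n = c + L y` on the cell's slab. -/
theorem setIntegral_p1Bary_affine_p1RealCell {a h : ℝ} (ha : 0 < a) (hh : 0 < h) (i : (ℤ × ℤ × ℤ) × Fin 6) (m : Fin 4) :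
    ∫ y in p1RealCell a h i, p1Bary (p1Par i.1) i.2 m ((p1ChartInvAff a h i.1.1 0 - p1Vec i.1) + p1ChartInvCLM a h i.1.1 y) =
      √3 * a ^ 2 * h / 48 := by
  set c : Fin 3 → ℝ := p1ChartInvAff a h i.1.1 0 - p1Vec i.1 with hc
  set Lℓ : (Fin 3 → ℝ) →ₗ[ℝ] (Fin 3 → ℝ) := ((p1ChartInvCLM a h i.1.1 : (Fin 3 → ℝ) →L[ℝ] (Fin 3 → ℝ)) : (Fin 3 → ℝ) →ₗ[ℝ] (Fin 3 → ℝ))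
    with hL
  have h3 : 0 < √3 := Real.sqrt_pos.2 (by norm_num)
  have hdet : LinearMap.det Lℓ = 2 / (√3 * a ^ 2 * h) := det_p1ChartInvCLM a h i.1.1
  have hdet0 : LinearMap.det Lℓ ≠ 0 := by rw [hdet]; positivity
  have hmeasR : MeasurableSet (p1RefCell (p1Par i.1) i.2) := (isClosed_p1RefCell _ _).measurableSet
  have hmeasS : MeasurableSet ((fun q => c + q) ⁻¹' p1RefCell (p1Par i.1) i.2) :=
    hmeasR.preimage (continuous_const.add continuous_id).measurable
  have hmeasC : MeasurableSet (p1RealCell a h i) := (isClosed_p1RealCell a h i).measurableSet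
  -- the integrand as `G ∘ L`
  set G : (Fin 3 → ℝ) → ℝ := ((fun q => c + q) ⁻¹' p1RefCell (p1Par i.1) i.2).indicator fun z => p1Bary (p1Par i.1) i.2 m (c + z) with hG
  have hGm : Measurable G := by
    refine Measurable.indicator ?_ hmeasS
    have : Continuous fun z : Fin 3 → ℝ => p1Bary (p1Par i.1) i.2 m (c + z) := by unfold p1Bary; fun_prop
    exact this.measurable
  have hcell : p1RealCell a h i = Lℓ ⁻¹' ((fun q => c + q) ⁻¹' p1RefCell (p1Par i.1) i.2) := p1RealCell_eq_preimage a h i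
  have step1 : ∫ y in p1RealCell a h i, p1Bary (p1Par i.1) i.2 m (c + p1ChartInvCLM a h i.1.1 y) = ∫ y, G (Lℓ y) := by
    rw [← integral_indicator hmeasC]
    congr 1
    funext y
    rw [hcell]
    by_cases hy : Lℓ y ∈ (fun q => c + q) ⁻¹' p1RefCell (p1Par i.1) i.2
    · rw [indicator_of_mem (mem_preimage.2 hy), hG, indicator_of_mem hy]
      rfl
    · rw [indicator_of_notMem (fun h' => hy (mem_preimage.1 h')), hG, indicator_of_notMem hy]
  have step2 : ∫ y, G (Lℓ y) = (√3 * a ^ 2 * h / 2) * ∫ z, G z := by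
    have hmap := Measure.map_linearMap_addHaar_eq_smul_addHaar volume hdet0
    have hf : AEStronglyMeasurable G (Measure.map Lℓ volume) := hGm.aestronglyMeasurable
    rw [← integral_map (Lℓ.continuous_of_finiteDimensional.measurable.aemeasurable) hf, hmap, integral_smul_measure, hdet,
      inv_div, abs_of_pos (by positivity), ENNReal.toReal_ofReal (by positivity), smul_eq_mul]
  have step3 : ∫ z, G z = 1 / 24 := by
    have e : G = fun z => ((p1RefCell (p1Par i.1) i.2).indicator fun w => p1Bary (p1Par i.1) i.2 m w) (c + z) := by
      funext z
      by_cases hz : c + z ∈ p1RefCell (p1Par i.1) i.2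
      · rw [hG, indicator_of_mem (mem_preimage.2 hz), indicator_of_mem hz]
      · rw [hG, indicator_of_notMem (fun h' => hz (mem_preimage.1 h')), indicator_of_notMem hz]
    rw [e, integral_add_left_eq_self (fun w => (p1RefCell (p1Par i.1) i.2).indicator (fun w => p1Bary (p1Par i.1) i.2 m w) w) c,
      integral_indicator hmeasR, setIntegral_p1Bary_p1RefCell]
  rw [step1, step2, step3]
  ring

/-- **First moments of the real cells: `∫_{cell (n,π)} λ_m(T⁻¹y − n) dy = √3·a²·h/48 = |cell|/4`** — the cell integral of the hat function of
each of its four vertices (`p1Hat_vert`).  NOT a proof of H12⋆, NOT summit progress. -/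
theorem setIntegral_p1Bary_p1RealCell {a h : ℝ} (ha : 0 < a) (hh : 0 < h) (i : (ℤ × ℤ × ℤ) × Fin 6) (m : Fin 4) :
    ∫ y in p1RealCell a h i, p1Bary (p1Par i.1) i.2 m (p1ChartInv a h y - p1Vec i.1) = √3 * a ^ 2 * h / 48 := by
  rw [← setIntegral_p1Bary_affine_p1RealCell ha hh i m]
  refine setIntegral_congr_fun (isClosed_p1RealCell a h i).measurableSet fun y hy => ?_
  have hs := p1RealCell_slab hy
  rw [p1ChartInv_eq_clm a h i.1.1 hs.1 hs.2]
  abel_nf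

end Summit.AtomisticToContinuum.Crystallization.Theorems.StrictSplittingRuleBirth

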